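import Summits.CriticalPhenomena.CardyFormulaZ2.Theorems.CardyIKTransportCornerLineDescentDiluteInfluenceReduction
import Mathlib.Analysis.Calculus.MeanValue
import Mathlib.Analysis.Complex.CauchyIntegral
import Mathlib.MeasureTheory.Integral.CircleIntegral

/-!
# The boundary layer of a tame rectangle has `O(δ⁻¹)` faces (`tame_boundaryLayer_card`)

Support file (`--supports stmt-CriticalPhenomena-10964`, registered sub-goal `tame_boundaryLayer_card`) for the
line `symmetric-seed-second-order` of the crux `CardyIKTransport.CornerLineDescent` (lead c4 reshape: the two open
influence stubs are asked over TAME conformal rectangles only).  The per-face reductions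
`influenceBoundOn_of_bulk_and_layer_bound` / `diluteBoundOn_of_bulk_and_layer_bound` need an exceptional
"boundary layer" `E : Finset (Site 2)` of at most `C δ⁻¹` lattice faces; here it is supplied GEOMETRICALLY for a tame
rectangle `R` (carrier `= G(𝔻)`, `G` holomorphic and injective on a disc of radius `r > 1`): for every `C₁ > 0`
there is `C` such that for `0 < δ ≤ 1` the faces `f ∈ ℤ²` whose mesh-`δ` position `δ (f₀ + i f₁)` is within
`C₁ δ` of `∂R` form a finite set of `≤ C δ⁻¹` elements.

Proof (pure geometry): `G` is `L`-Lipschitz on the closed unit disc (its derivative is continuous on the larger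
open disc, mean value inequality); `∂R ⊆ G(unit circle)` (`closure G(𝔻) ⊆ G(closed disc)` by compactness, and
`∂R ∩ R = ∅`); the unit circle is the `1`-Lipschitz image `circleMap 0 1 '' [0, 2π)`; so `∂R` is covered by the
`N + 1 = O(L/δ)` discs of radius `δ` centred at `G(e^{2πik/N})`, and the faces within `C₁ δ` of one such disc lie in
a translate of `latticeBox ⌈C₁ + 2⌉₊` (`(2⌈C₁+2⌉₊+1)²` faces).
-/

noncomputable section

namespace Summit.CriticalPhenomena.CardyFormulaZ2.Theorems.CornerLineDescent.SymmetricSeed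

open scoped Topology
open Filter Set Metric
open Literature.Probability.LatticeModels
open Literature.Probability.RandomPlanarGeometry

/-- A function holomorphic on a disc of radius `r > 1` is Lipschitz on the closed unit disc (continuity of the
derivative on the compact closed disc + the mean value inequality on a convex set). [folklore] -/
theorem TameBoundaryLayer.exists_lipschitz_closedBall {G : ℂ → ℂ} {r : ℝ} (hr : 1 < r)
    (hG : DifferentiableOn ℂ G (ball 0 r)) :
    ∃ L : ℝ, 0 ≤ L ∧ ∀ x ∈ closedBall (0:ℂ) 1, ∀ y ∈ closedBall (0:ℂ) 1, ‖G x - G y‖ ≤ L * ‖x - y‖ := by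
  have hsub : closedBall (0:ℂ) 1 ⊆ ball 0 r := closedBall_subset_ball hr
  have hcont : ContinuousOn (deriv G) (ball 0 r) :=
    (hG.contDiffOn isOpen_ball (n := 1)).continuousOn_deriv_of_isOpen isOpen_ball le_rfl
  obtain ⟨L, hL⟩ := (isCompact_closedBall (0:ℂ) 1).exists_bound_of_continuousOn (hcont.mono hsub)
  have hL0 : 0 ≤ L := (norm_nonneg _).trans (hL 0 (mem_closedBall_self zero_le_one))
  refine ⟨L, hL0, fun x hx y hy => ?_⟩
  exact (convex_closedBall (0:ℂ) 1).norm_image_sub_le_of_norm_deriv_le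
    (fun z hz => hG.differentiableAt (isOpen_ball.mem_nhds (hsub hz))) hL hy hx

/-- For a tame rectangle (`R.carrier = G(𝔻)`, `G` continuous on the closed unit disc), `∂R ⊆ G(unit circle)`:
`closure G(𝔻) ⊆ G(closed disc)` (a compact, hence closed, superset of `G(𝔻)`) and `∂R` misses the open set `R`.
[folklore] -/
theorem TameBoundaryLayer.frontier_subset_image_sphere {R : ConformalRectangle} {G : ℂ → ℂ} {r : ℝ}
    (hr : 1 < r) (hG : DifferentiableOn ℂ G (ball 0 r)) (hcar : R.carrier = G '' ball 0 1) :
    frontier R.carrier ⊆ G '' sphere 0 1 := by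
  intro w hw
  rw [R.isOpen.frontier_eq] at hw
  have hsub : closedBall (0:ℂ) 1 ⊆ ball 0 r := closedBall_subset_ball hr
  have hK : IsCompact (G '' closedBall 0 1) :=
    (isCompact_closedBall (0:ℂ) 1).image_of_continuousOn (hG.continuousOn.mono hsub)
  have hcl : closure R.carrier ⊆ G '' closedBall 0 1 := by
    rw [hcar]
    exact closure_minimal (image_mono ball_subset_closedBall) hK.isClosed
  obtain ⟨z, hz, rfl⟩ := hcl hw.1
  refine ⟨z, ?_, rfl⟩
  have hz1 : ‖z‖ ≤ 1 := mem_closedBall_zero_iff.1 hz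
  have hz2 : ¬ ‖z‖ < 1 := fun h => hw.2 (by rw [hcar]; exact ⟨z, mem_ball_zero_iff.2 h, rfl⟩)
  rw [mem_sphere_zero_iff_norm]
  exact le_antisymm hz1 (not_lt.1 hz2)

/-- Every point of the unit circle is `circleMap 0 1 θ` for some `θ ∈ [0, 2π)`. [folklore] -/
theorem TameBoundaryLayer.exists_circleMap_eq {z : ℂ} (hz : z ∈ sphere (0:ℂ) 1) :
    ∃ θ ∈ Ico 0 (2 * Real.pi), circleMap 0 1 θ = z := by
  have h : z ∈ range (circleMap 0 1) := by rw [range_circleMap, abs_one]; exact hz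
  obtain ⟨θ', rfl⟩ := h
  obtain ⟨θ, hθ, h⟩ := (periodic_circleMap 0 1).exists_mem_Ico₀ Real.two_pi_pos θ'
  exact ⟨θ, hθ, h.symm⟩

/-- `circleMap 0 1` is `1`-Lipschitz (its derivative `i e^{iθ}` has norm `1`). [folklore] -/
theorem TameBoundaryLayer.norm_circleMap_sub_le (a b : ℝ) :
    ‖circleMap 0 1 a - circleMap 0 1 b‖ ≤ |a - b| := by
  have hd : ∀ x ∈ (univ : Set ℝ), ‖deriv (circleMap 0 1) x‖ ≤ 1 := fun x _ => by
    rw [deriv_circleMap, norm_mul, norm_circleMap_zero, Complex.norm_I, mul_one, abs_one]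
  have h := convex_univ.norm_image_sub_le_of_norm_deriv_le (fun x _ => differentiable_circleMap 0 1 x) hd
    (mem_univ b) (mem_univ a)
  rwa [one_mul, Real.norm_eq_abs] at h

/-- An angle `θ ∈ [0, 2π)` is within `2π/N` of a grid angle `2πk/N` with `k ≤ N` (`k := ⌊θN/(2π)⌋₊`). [folklore] -/
theorem TameBoundaryLayer.exists_grid_angle {θ : ℝ} (hθ : θ ∈ Ico 0 (2 * Real.pi)) {N : ℕ} (hN : 0 < N) :
    ∃ k : ℕ, k ≤ N ∧ |θ - 2 * Real.pi * k / N| ≤ 2 * Real.pi / N := by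
  have hπ : 0 < 2 * Real.pi := Real.two_pi_pos
  have hNr : (0:ℝ) < N := Nat.cast_pos.2 hN
  have ht0 : 0 ≤ θ * N / (2 * Real.pi) := div_nonneg (mul_nonneg hθ.1 hNr.le) hπ.le
  have h1 : (⌊θ * N / (2 * Real.pi)⌋₊ : ℝ) ≤ θ * N / (2 * Real.pi) := Nat.floor_le ht0
  have h2 : θ * N / (2 * Real.pi) < ⌊θ * N / (2 * Real.pi)⌋₊ + 1 := Nat.lt_floor_add_one _
  rw [le_div_iff₀ hπ] at h1
  rw [div_lt_iff₀ hπ] at h2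
  have h3 : θ * N < 2 * Real.pi * N := mul_lt_mul_of_pos_right hθ.2 hNr
  refine ⟨⌊θ * N / (2 * Real.pi)⌋₊, ?_, ?_⟩
  · have h4 : (⌊θ * N / (2 * Real.pi)⌋₊ : ℝ) < N := by nlinarith
    exact_mod_cast h4.le
  · have e : θ - 2 * Real.pi * (⌊θ * N / (2 * Real.pi)⌋₊ : ℝ) / N =
        (θ * N - 2 * Real.pi * ⌊θ * N / (2 * Real.pi)⌋₊) / N := by
      field_simp
    rw [e, abs_div, abs_of_pos hNr, div_le_div_iff_of_pos_right hNr, abs_le]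
    constructor <;> linarith

/-- An integer `a` with `|a - x| + 1 ≤ M` satisfies `|a - ⌊x⌋| ≤ M`. [folklore] -/
theorem TameBoundaryLayer.abs_sub_floor_le {a : ℤ} {x : ℝ} {M : ℕ} (h : |(a : ℝ) - x| + 1 ≤ M) :
    |a - ⌊x⌋| ≤ (M : ℤ) := by
  have h1 : |(a : ℝ) - (⌊x⌋ : ℝ)| ≤ M := by
    have h2 : |x - (⌊x⌋ : ℝ)| < 1 := by
      rw [Int.self_sub_floor, abs_of_nonneg (Int.fract_nonneg x)]
      exact Int.fract_lt_one x
    linarith [abs_sub_le (a:ℝ) x (⌊x⌋ : ℝ)]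
  have h3 : ((|a - ⌊x⌋| : ℤ) : ℝ) ≤ ((M : ℤ) : ℝ) := by push_cast; exact h1
  exact_mod_cast h3

/-- The faces `f` whose position `f₀ + i f₁` satisfies `‖(f₀ + i f₁) - u‖ + 1 ≤ M` lie in a translate of
`latticeBox M`, a finset of `≤ (2M+1)²` faces. [folklore] -/
theorem TameBoundaryLayer.exists_box (u : ℂ) (M : ℕ) :
    ∃ B : Finset (Site 2), B.card ≤ (2 * M + 1) ^ 2 ∧ ∀ f : Site 2,
      ‖((((f 0 : ℤ) : ℝ) : ℂ) + (((f 1 : ℤ) : ℝ) : ℂ) * Complex.I) - u‖ + 1 ≤ M → f ∈ B := by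
  classical
  obtain ⟨g, hg0, hg1⟩ : ∃ g : Site 2, g 0 = ⌊u.re⌋ ∧ g 1 = ⌊u.im⌋ := ⟨![⌊u.re⌋, ⌊u.im⌋], rfl, rfl⟩
  refine ⟨(latticeBox M).image fun h => h + g, Finset.card_image_le.trans (card_latticeBox_le M),
    fun f hf => ?_⟩
  set v : ℂ := ((((f 0 : ℤ) : ℝ) : ℂ) + (((f 1 : ℤ) : ℝ) : ℂ) * Complex.I) - u with hv
  have hre : |((f 0 : ℤ) : ℝ) - u.re| ≤ ‖v‖ := by
    have := Complex.abs_re_le_norm v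
    simpa [hv] using this
  have him : |((f 1 : ℤ) : ℝ) - u.im| ≤ ‖v‖ := by
    have := Complex.abs_im_le_norm v
    simpa [hv] using this
  rw [Finset.mem_image]
  refine ⟨f - g, mem_latticeBox ?_ ?_, sub_add_cancel f g⟩
  · rw [Pi.sub_apply, hg0]
    exact TameBoundaryLayer.abs_sub_floor_le (by linarith)
  · rw [Pi.sub_apply, hg1]
    exact TameBoundaryLayer.abs_sub_floor_le (by linarith)

/-- THE BOUNDARY LAYER OF A TAME RECTANGLE HAS `O(δ⁻¹)` FACES.  For a tame conformal rectangle `R`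
(`R.carrier = G(𝔻)` with `G` holomorphic and injective on a disc of radius `r > 1`) and every `C₁ > 0` there is
`C` such that for every mesh `0 < δ ≤ 1` the lattice faces `f ∈ ℤ²` whose position `δ (f₀ + i f₁)` is within
`C₁ δ` of `∂R` form a finset of at most `C δ⁻¹` elements (`∂R ⊆ G(unit circle)` and `G` is Lipschitz on the
closed unit disc, so `∂R` is covered by `O(δ⁻¹)` discs of radius `δ`, each meeting `O(1)` such faces). [folklore] -/
theorem tame_boundaryLayer_card :
    ∀ (R : ConformalRectangle), (∃ G : ℂ → ℂ, ∃ r : ℝ, 1 < r ∧ DifferentiableOn ℂ G (Metric.ball 0 r) ∧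
      Set.InjOn G (Metric.ball 0 r) ∧ R.carrier = G '' Metric.ball 0 1) →
    ∀ C₁ : ℝ, 0 < C₁ → ∃ C : ℝ, ∀ δ : ℝ, 0 < δ → δ ≤ 1 → ∃ E : Finset (Site 2), (E.card : ℝ) ≤ C * δ⁻¹ ∧
      ∀ f : Site 2, f ∈ E ↔
        Metric.infDist ((δ:ℂ) * (((f 0 : ℝ) : ℂ) + ((f 1 : ℝ) : ℂ) * Complex.I)) (frontier R.carrier) ≤ C₁ * δ := by
  classical
  rintro R ⟨G, r, hr, hG, -, hcar⟩ C₁ hC₁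
  obtain ⟨L, hL0, hL⟩ := TameBoundaryLayer.exists_lipschitz_closedBall hr hG
  have hfr : frontier R.carrier ⊆ G '' sphere 0 1 := TameBoundaryLayer.frontier_subset_image_sphere hr hG hcar
  have hne : (frontier R.carrier).Nonempty := ⟨R.pt 0, R.pt_mem_frontier 0⟩
  choose B hBcard hBmem using TameBoundaryLayer.exists_box
  obtain ⟨M, hM⟩ : ∃ M : ℕ, M = ⌈C₁ + 2⌉₊ := ⟨_, rfl⟩
  have hπL : 0 ≤ 2 * Real.pi * L := mul_nonneg (mul_nonneg zero_le_two Real.pi_pos.le) hL0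
  refine ⟨(2 * Real.pi * L + 3) * ((2 * M + 1 : ℕ) : ℝ) ^ 2, fun δ hδ hδ1 => ?_⟩
  obtain ⟨N, hN⟩ : ∃ N : ℕ, N = ⌈2 * Real.pi * L / δ⌉₊ + 1 := ⟨_, rfl⟩
  have hN0 : 0 < N := by rw [hN]; exact Nat.succ_pos _
  have hNr : (0:ℝ) < N := Nat.cast_pos.2 hN0
  have hNreal : (N : ℝ) = (⌈2 * Real.pi * L / δ⌉₊ : ℝ) + 1 := by rw [hN, Nat.cast_add, Nat.cast_one]
  have hle : 2 * Real.pi * L / δ ≤ N := by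
    rw [hNreal]; exact (Nat.le_ceil _).trans (le_add_of_nonneg_right zero_le_one)
  obtain ⟨u, hu⟩ : ∃ u : ℕ → ℂ, ∀ k, u k = G (circleMap 0 1 (2 * Real.pi * k / N)) / δ := ⟨_, fun _ => rfl⟩
  refine ⟨((Finset.range (N + 1)).biUnion fun k => B (u k) M).filter fun f =>
    Metric.infDist ((δ:ℂ) * (((f 0 : ℝ) : ℂ) + ((f 1 : ℝ) : ℂ) * Complex.I)) (frontier R.carrier) ≤ C₁ * δ,
    ?_, fun f => ?_⟩
  · -- the cardinality bound `≤ (N + 1) (2M+1)² ≤ (2πL + 3) (2M+1)² δ⁻¹`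
    have h1 : (((Finset.range (N + 1)).biUnion fun k => B (u k) M).filter fun f =>
        Metric.infDist ((δ:ℂ) * (((f 0 : ℝ) : ℂ) + ((f 1 : ℝ) : ℂ) * Complex.I)) (frontier R.carrier) ≤
          C₁ * δ).card ≤ (N + 1) * (2 * M + 1) ^ 2 := by
      refine (Finset.card_filter_le _ _).trans (Finset.card_biUnion_le.trans ?_)
      refine (Finset.sum_le_card_nsmul _ _ _ fun k _ => hBcard (u k) M).trans ?_
      rw [Finset.card_range, smul_eq_mul]
    have h2 : ((N + 1 : ℕ) : ℝ) ≤ (2 * Real.pi * L + 3) * δ⁻¹ := by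
      have hc : (⌈2 * Real.pi * L / δ⌉₊ : ℝ) < 2 * Real.pi * L / δ + 1 :=
        Nat.ceil_lt_add_one (div_nonneg hπL hδ.le)
      have hinv : 1 ≤ δ⁻¹ := (one_le_inv₀ hδ).2 hδ1
      have hc' : 2 * Real.pi * L / δ = 2 * Real.pi * L * δ⁻¹ := div_eq_mul_inv _ _
      rw [Nat.cast_add, Nat.cast_one, hNreal]
      nlinarith
    calc ((((Finset.range (N + 1)).biUnion fun k => B (u k) M).filter fun f =>
        Metric.infDist ((δ:ℂ) * (((f 0 : ℝ) : ℂ) + ((f 1 : ℝ) : ℂ) * Complex.I)) (frontier R.carrier) ≤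
          C₁ * δ).card : ℝ)
        ≤ ((N + 1 : ℕ) : ℝ) * ((2 * M + 1 : ℕ) : ℝ) ^ 2 := by exact_mod_cast h1
      _ ≤ (2 * Real.pi * L + 3) * δ⁻¹ * ((2 * M + 1 : ℕ) : ℝ) ^ 2 :=
          mul_le_mul_of_nonneg_right h2 (sq_nonneg _)
      _ = (2 * Real.pi * L + 3) * ((2 * M + 1 : ℕ) : ℝ) ^ 2 * δ⁻¹ := by ring
  · -- membership: the filter predicate, and the covering of the layer by the boxes
    rw [Finset.mem_filter]
    refine ⟨fun h => h.2, fun h => ⟨?_, h⟩⟩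
    set x : ℂ := (((f 0 : ℤ) : ℝ) : ℂ) + (((f 1 : ℤ) : ℝ) : ℂ) * Complex.I with hx
    obtain ⟨w, hw, hwd⟩ := isClosed_frontier.exists_infDist_eq_dist hne ((δ:ℂ) * x)
    obtain ⟨z, hz, rfl⟩ := hfr hw
    obtain ⟨θ, hθ, rfl⟩ := TameBoundaryLayer.exists_circleMap_eq hz
    obtain ⟨k, hkN, hk⟩ := TameBoundaryLayer.exists_grid_angle hθ hN0
    rw [Finset.mem_biUnion]
    refine ⟨k, Finset.mem_range.2 (Nat.lt_succ_of_le hkN), hBmem (u k) M f ?_⟩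
    have hzk : ‖G (circleMap 0 1 θ) - G (circleMap 0 1 (2 * Real.pi * k / N))‖ ≤ δ := by
      calc ‖G (circleMap 0 1 θ) - G (circleMap 0 1 (2 * Real.pi * k / N))‖
          ≤ L * ‖circleMap 0 1 θ - circleMap 0 1 (2 * Real.pi * k / N)‖ :=
            hL _ (circleMap_mem_closedBall 0 zero_le_one _) _ (circleMap_mem_closedBall 0 zero_le_one _)
        _ ≤ L * (2 * Real.pi / N) :=
            mul_le_mul_of_nonneg_left ((TameBoundaryLayer.norm_circleMap_sub_le _ _).trans hk) hL0
        _ ≤ δ := by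
            rw [div_le_iff₀ hδ] at hle
            rw [mul_div_assoc', div_le_iff₀ hNr]
            linarith
    have hd1 : ‖(δ:ℂ) * x - G (circleMap 0 1 θ)‖ ≤ C₁ * δ := by
      rw [← dist_eq_norm, ← hwd]; exact h
    have hd2 : ‖(δ:ℂ) * x - G (circleMap 0 1 (2 * Real.pi * k / N))‖ ≤ (C₁ + 1) * δ := by
      calc ‖(δ:ℂ) * x - G (circleMap 0 1 (2 * Real.pi * k / N))‖
          ≤ ‖(δ:ℂ) * x - G (circleMap 0 1 θ)‖ +
              ‖G (circleMap 0 1 θ) - G (circleMap 0 1 (2 * Real.pi * k / N))‖ :=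
            norm_sub_le_norm_sub_add_norm_sub _ _ _
        _ ≤ C₁ * δ + δ := add_le_add hd1 hzk
        _ = (C₁ + 1) * δ := by ring
    have hd3 : ‖x - u k‖ ≤ C₁ + 1 := by
      have e : (δ:ℂ) * x - G (circleMap 0 1 (2 * Real.pi * k / N)) = (δ:ℂ) * (x - u k) := by
        rw [hu, mul_sub, mul_div_cancel₀ _ (Complex.ofReal_ne_zero.2 hδ.ne')]
      rw [e, norm_mul, Complex.norm_of_nonneg hδ.le, mul_comm (C₁ + 1) δ] at hd2
      exact le_of_mul_le_mul_left hd2 hδ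
    calc ‖x - u k‖ + 1 ≤ C₁ + 2 := by linarith
      _ ≤ M := by rw [hM]; exact Nat.le_ceil _

end Summit.CriticalPhenomena.CardyFormulaZ2.Theorems.CornerLineDescent.SymmetricSeed
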